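import Literature.AnabelianGeometry.AbsoluteAnabelian.AbsTopIII.ReconstructionThm19FunctorialAut
import Literature.AnabelianGeometry.AbsoluteAnabelian.AbsTopIII.ReconstructionThm19FunctorialNonVacuity
import HarnessLib

/-!
# [AbsTopIII] Thm. 1.9 with inner AND geometric functoriality (`Thm_1_9aut'`): a satisfiability witness with the
# MAXIMAL recorded set of automorphisms

S. Mochizuki, *Topics in Absolute Anabelian Geometry III*, J. Math. Sci. Univ. Tokyo **22** (2015) [AbsTopIII],
Thm. 1.9 pp. 37–38, Rmk. 1.9.5 (i) p. 39 (lit key `paper:url-5493eb38cbb7`).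

Cell `abc-iut`, seat abc-iut-c312-2 (L4 lineage; X-143 owner).  `Thm_1_9aut' M ρ` (`ReconstructionThm19FunctorialAut.lean`,
abc-iut-c312-2 gen 13) extends `Thm_1_9'` by equivariance of the (e)-comparison under the model's RECORDED GEOMETRIC
automorphisms `ρ.geomAut`.  Its kernel record so far: law checks A1–A4 + conservativity (★ `ReconstructionThm19FunctorialAutLaws`,
crit-A g7), no inhabitant beyond `geomAut := ∅` (where it IS `Thm_1_9'`).  THIS FILE (proof-only apart from the one toy
datum `ρ₀aut`; zero anabelian content) records that the toy algorithm `toyAlg` of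
`ReconstructionThm19FunctorialNonVacuity.lean` witnesses `Thm_1_9aut'` at the toy model with the LARGEST possible recorded set —
EVERY automorphism `α` of the extension `E₀ = (G_ℚ × 𝔖₃ ↠ G_ℚ)`, each recorded with its renaming action `permField (arithPerm α)`
on `K₀ = Frac(ℚ̄_NF[X_h : h ∈ Π₀])`:

* `toyMapFun_self` — at `E₀` the transport along ANY automorphism `α` is `permField (arithPerm α)` (the anchor at `E₀` is the
  identity), so the algorithm's typed functoriality is a genuine homomorphism `Aut(E₀) → Aut(K₀)`, not only on inner ones;
* `ρ₀aut` — `ρ₀` with `geomAut := {(α, permField (arithPerm α)) | α : E₀ ≅ E₀}`; `witnessedByAut_toyAlg`, `thm_1_9aut'_toyModelNV`;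
* `Thm_1_9aut'.exists_witness_allAut` — packaged: a model, a recorded inner action that MOVES an element at a Thm-1.9 input curve,
  a recorded geometric set containing EVERY automorphism of the extension with a FAITHFUL-on-variables action, and a
  non-inner-trivial algorithm witnessing `Thm_1_9aut'`.

HONEST LABEL — TOY / JUNK, and ONE CAVEAT STATED, NOT DECIDED: whether `E₀ = G_ℚ × 𝔖₃` possesses an automorphism over `G_ℚ` that
is NOT inner is not decided here (every automorphism over the identity of `G_ℚ` is inner because `Z(𝔖₃) = 1`; over a non-trivial
automorphism of `G_ℚ` the question is the Neukirch–Uchida-type rigidity of `G_ℚ`, not in the tree) — so this witness certifies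
joint satisfiability of the aut-clause for the maximal recorded set, and says nothing about print or about the named IUT pair.
Nothing of [AbsTopIII] is proved; nothing here bears on [IUTchIII] Cor. 3.12 or asserts that abc is proved or refuted; typed ≠
inhabited-at-a-toy ≠ proved-in-print.  No `instance`, no notation, no axiom, no `sorry`.
-/

noncomputable section

open CategoryTheory
open scoped Pointwise

namespace Literature.AnabelianGeometry.AbsoluteAnabelian.AbsTopIII

namespace Thm19FunctorialNV

open CurveModelSchemaWitness

/-- **At `E₀` the transport along ANY automorphism `α : E₀ ≅ E₀` is renaming along `arithPerm α`** (the anchor at `E₀` is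
`Iso.refl`). [cite: MochizukiAbsTopIII2015, Thm 1.9 p.38] -/
theorem toyMapFun_self (α : E₀ ≅ E₀) : toyMapFun α = (permField (arithPerm α)).toRingEquiv := by
  unfold toyMapFun
  rw [dif_pos ⟨Iso.refl E₀⟩]
  simp only [anchor_self, Iso.refl_symm, Iso.refl_trans, Iso.trans_refl]

/-- **The recorded inner action AND the maximal recorded geometric set** at the single toy curve: `ρ₀` (conjugation renaming)
together with EVERY automorphism `α` of `E₀`, recorded with its renaming action `permField (arithPerm α)`.
[cite: MochizukiAbsTopIII2015, Thm 1.9 p.38] -/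
def ρ₀aut : toyModelNV.NFGaloisAutAction :=
  { ρ₀ with geomAut := fun _ => Set.range fun α : E₀ ≅ E₀ => (α, (permField (arithPerm α)).toRingEquiv) }

/-- `rfl` read-out: the underlying inner datum of `ρ₀aut` is `ρ₀`. [cite: MochizukiAbsTopIII2015, Thm 1.9 p.38] -/
theorem ρ₀aut_toNFGaloisAction : ρ₀aut.toNFGaloisAction = ρ₀ := rfl

/-- Every automorphism of `E₀` is recorded. [cite: MochizukiAbsTopIII2015, Thm 1.9 p.38] -/
theorem mem_ρ₀aut_geomAut (α : E₀ ≅ E₀) :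
    (α, (permField (arithPerm α)).toRingEquiv) ∈ ρ₀aut.geomAut PUnit.unit := ⟨α, rfl⟩

/-- The recorded geometric action is FAITHFUL on variables: `α` moves `X_h` to `X_{α(h)}`.
[cite: MochizukiAbsTopIII2015, Thm 1.9 p.38] -/
theorem permField_arithPerm_X (α : E₀ ≅ E₀) (h : E₀.arith) :
    permField (arithPerm α) (algebraMap P₀ K₀ (MvPolynomial.X h)) = algebraMap P₀ K₀ (MvPolynomial.X (α.hom.arith h)) := by
  rw [permField_algebraMap, MvPolynomial.rename_X]
  rfl

/-- **`Thm_1_9aut'.WitnessedBy toyModelNV ρ₀aut toyAlg`**: clauses (a)(d)(e) and the inner clause from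
`witnessedBy_toyAlg`; the geometric clause with the SAME comparison `φ := id` by `toyMapFun_self`.
[cite: MochizukiAbsTopIII2015, Thm 1.9 pp.37-38] -/
theorem witnessedByAut_toyAlg : Thm_1_9aut'.WitnessedBy toyModelNV ρ₀aut toyAlg := by
  refine ⟨witnessedBy_toyAlg.1, fun i _ => ?_⟩
  refine ⟨RingEquiv.refl _, fun g x => ?_, ?_⟩
  · show toyMapFun (E₀.innerIso g) x = permField (MulAut.conj g).toEquiv x
    rw [toyMapFun_innerIso]
    rfl
  · rintro p ⟨α, rfl⟩ x
    show toyMapFun α x = permField (arithPerm α) x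
    rw [toyMapFun_self]
    rfl

/-- **`Thm_1_9aut'` HOLDS at `(toyModelNV, ρ₀aut)`.** [cite: MochizukiAbsTopIII2015, Thm 1.9 pp.37-38] -/
theorem thm_1_9aut'_toyModelNV : Thm_1_9aut' toyModelNV ρ₀aut := ⟨toyAlg, witnessedByAut_toyAlg⟩

end Thm19FunctorialNV

open Thm19FunctorialNV in
/-- **Satisfiability of `Thm_1_9aut'` with the MAXIMAL recorded set** (vacuity audit of the strengthened named fact): there
are a model `M`, a recorded datum `ρ`, an algorithm `A` and a recorded curve `i` such that `A` witnesses `Thm_1_9aut'` at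
`(M, ρ)`, the curve IS a Thm-1.9 input, the recorded inner action MOVES an element, EVERY automorphism of the extension is
recorded (with an action faithful on the variables of `K₀`), and `A` is NOT inner-trivial.  TOY data; whether the extension
has a non-inner automorphism is not decided here (module docstring). [cite: MochizukiAbsTopIII2015, Thm 1.9 pp.37-38] -/
theorem Thm_1_9aut'.exists_witness_allAut :
    ∃ (M : CurveModel.{0}) (ρ : M.NFGaloisAutAction) (A : NFPortionAlgorithm.{0}) (i : ρ.ι),
      Thm_1_9aut'.WitnessedBy M ρ A ∧ M.IsThm19Input (ρ.curve i) ∧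
        (∃ (g : (M.ext (ρ.curve i)).arith) (f : M.NFFunctionField (ρ.curve i)), ρ.act i g f ≠ f) ∧
        (∀ α : M.ext (ρ.curve i) ≅ M.ext (ρ.curve i), ∃ τ, (α, τ) ∈ ρ.geomAut i) ∧
        ¬ A.IsInnerTrivialAt (M.ext (ρ.curve i)) :=
  ⟨toyModelNV, ρ₀aut, toyAlg, PUnit.unit, witnessedByAut_toyAlg, isThm19Input_toyModelNV _, ρ₀_moves,
    fun α => ⟨_, mem_ρ₀aut_geomAut α⟩, toyAlg_not_isInnerTrivialAt⟩

end Literature.AnabelianGeometry.AbsoluteAnabelian.AbsTopIII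

end
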